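import Summits.QuantumFields.BalabanUV.Beta.EriceFlowEnclosureB12AsPrintedHistoryContagionShiftFlowZeroTwoLoop
import Summits.QuantumFields.BalabanUV.Beta.EriceFlowEnclosureB12AsPrintedHistoryContagionShiftFlowZeroOffset

/-!
# Beta / EriceFlowEnclosureB12AsPrintedHistoryContagionShiftFlowZeroTwoLoopPin — ASYMPTOTIC FREEDOM IS CONTAGIOUS, part 40: THE TWO-LOOP Λ-PARAMETER AS AN RG-INVARIANT
# COORDINATE NEAR ZERO PIN.  Part 39 gave EVERY asymptotically free trajectory t of a fading-memory flow with the two-loop letter (T2m) an ABSOLUTE two-loop Λ: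
# `1∕t(m)² − m·β₀ − (b₁∕β₀)·log m → Λ(t)`.  Here: (§63) along the trajectory itself **`Λ(t(k + ·)) = Λ(t) + k·β₀`** (`twoLoopLambda_tail`: re-pinning k scales into the
# ultraviolet RAISES the absolute Λ by EXACTLY k·β₀ — the two-loop logarithms cancel in the limit, `log(m+k) − log m → 0`; NO smallness), and the absolute Λ's of two
# trajectories near zero pin differ by part 34's RELATIVE Λ (`twoLoopLambda_sub_mem`: `Λ(h) − Λ(h′) ∈ [(2∕3)Δ₀, (4∕3)Δ₀]`, `Δ₀ = 1∕e² − 1∕e′²`); (§64) near zero pin, against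
# NO reference pin at all, the absolute two-loop Λ is a FUNCTION OF THE PIN (**`twoLoopLambdaFunction_exists`**): `Λ₂ : ℝ → ℝ` with `E_m(h) → Λ₂ e` for EVERY box solution h
# from every `e ∈ ]0, e′]`, **`(2∕3)(1∕e₁² − 1∕e₂²) ≤ Λ₂ e₁ − Λ₂ e₂ ≤ (4∕3)(1∕e₁² − 1∕e₂²)`**, `StrictAntiOn` ∕ `ContinuousOn` on ]0, e′], THE ABEL EQUATION **`Λ₂ (h k) = Λ₂ e +
# k·β₀`** (so `Λ₂∘R = Λ₂ + β₀` for part 31's one-step map), and **Λ₂ maps ]0, e′] ONTO [Λ₂ e′, ∞[ with unique pins** — the absolute two-loop Λ-parameter is a bi-Lipschitz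
# (in the chart), strictly monotone, continuous COORDINATE on the trajectories near the trivial fixed point in which the renormalization group is the translation by β₀: the
# flow-with-memory form of «Λ_QCD labels the theory», with one- and two-loop coefficients β₀, b₁∕β₀ read off any trajectory (part 39) and the constant FORCED.
# Abstract in B (β-flow team, prover 1, unit `b2b-balaban-beta-bflow-p1`, gen 39; ROW AP-I·Uc × ROW Λ × ROW D4-AUTONOMY — the two-loop Λ as a coordinate)

HONEST FRAMING (page 1 of everything the β sub-cell writes): discharging `BetaPertH` makes Bałaban's UV stability UNCONDITIONAL — a
real constructive-QFT result; it is NOT the continuum limit and NOT the Clay problem.  HONEST DEPENDENCY (cell reorg 2026-08-19,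
verbatim): «continuum YM on T⁴ ⇐ BetaPertH ∧ nine spine estimates (0/9 proved); BetaPertH ⇐ (D1) ∧ (D4) ∧ CAP+tail; G-an2-4 gates
asym, D1 and NE2/3/4.»  THIS MODULE DISCHARGES NOTHING: elementary real analysis (`limUnder`, uniqueness of limits, `log(m+k) − log m → 0`, the intermediate value theorem)
over node U2's HYPOTHESIS SHAPES on an ABSTRACT functional `B` with the displayed binders «value at zero» and (T2m); part 39's `exists_twoLoopLambda`, part 34's
`exists_relativeLambda ∕ package_of_le ∕ succ_le_of_reference_flow`, part 25's `tail_profile`, part 13's `memFlow_solution_of_reference ∕ eq_solution_of_memFlow_of_reference`,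
part 10's `invSq_lower_of_reference_flow`, d4-p2's `memFlow_tail`, node U2's `one_div_sq_one_div_sqrt` BY NAME — nothing restated.  PRECEDENT (floored, Markov letter, compact pin
interval; by name, not imported): d4-p2's (E54) `EriceRemainderEnclosureHistoryAutonomyTwoLoopLambdaPin` (`twoLoopLambda_pin_eq`, `continuousOn_twoLoopLambda_pin`,
`twoLoopLambda_lt_of_pin_lt`, `image_twoLoopLambda_Icc`).  Nothing is asserted about Bałaban's β ((T2m) for its limit functional is NOT PRINTED, [I] p. 298); «Λ-parameter» is
OUR READING.  [I] = T. Bałaban, Commun. Math. Phys. **109** (1987) 249–301 [Balaban1987RG1].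

WHAT THIS FILE PROVES (0 sorry, 0 def): §63 `tendsto_log_shift_sub`, **`twoLoopLambda_tail`**, **`twoLoopLambda_sub_mem`**; §64 **`twoLoopLambdaFunction_exists`**.  NOT CLAIMED:
anything about Bałaban's β; `BetaPertH`; continuum; Clay.
-/

namespace Summit.QuantumFields.BalabanUV.Beta.EriceFlowEnclosureB12AsPrintedHistoryContagionShiftFlowZeroTwoLoopPin

open Finset Filter Topology Set
open Literature.MathematicalPhysics.QuantumFieldTheory.Balaban1983to89
open Literature.MathematicalPhysics.QuantumFieldTheory.Balaban1983to89.T4CouplingMatching (sprof)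
open Literature.MathematicalPhysics.QuantumFieldTheory.Balaban1983to89.T4BetaStationary (SeqBox MemoryProfile)
open Literature.MathematicalPhysics.QuantumFieldTheory.Balaban1983to89.T4BetaFlowWellPosed (MemFlow solution seqBox_shift one_div_sq_one_div_sqrt)
open Summit.QuantumFields.BalabanUV.Beta.EriceRemainderEnclosureHistoryAutonomyOrder (memFlow_tail)
open Summit.QuantumFields.BalabanUV.Beta.EriceFlowEnclosureB12AsPrintedHistoryContagionShiftFlow (invSq_lower_of_reference_flow)
open Summit.QuantumFields.BalabanUV.Beta.EriceFlowEnclosureB12AsPrintedHistoryContagionShiftFlowPicardLimit (memFlow_solution_of_reference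
  eq_solution_of_memFlow_of_reference)
open Summit.QuantumFields.BalabanUV.Beta.EriceFlowEnclosureB12AsPrintedHistoryContagionShiftFlowRepinTail (one_div_sprof_pos tail_profile)
open Summit.QuantumFields.BalabanUV.Beta.EriceFlowEnclosureB12AsPrintedHistoryContagionShiftFlowZeroOffset (package_of_le succ_le_of_reference_flow exists_relativeLambda)
open Summit.QuantumFields.BalabanUV.Beta.EriceFlowEnclosureB12AsPrintedHistoryContagionShiftFlowZeroTwoLoop (exists_twoLoopLambda)

noncomputable section

/-! ## §63 Along one trajectory and between two trajectories -/

/-- `log(m + k) − log m → 0` along the naturals. [folklore] -/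
theorem tendsto_log_shift_sub (k : ℕ) : Tendsto (fun m : ℕ => Real.log ((m : ℝ) + k) - Real.log (m : ℝ)) atTop (𝓝 0) :=
  (Real.tendsto_log_comp_add_sub_log (k : ℝ)).comp tendsto_natCast_atTop_atTop

/-- **RE-PINNING RAISES THE ABSOLUTE TWO-LOOP Λ BY k·β₀.**  If the two-loop sequence of a trajectory t converges, `1∕t(m)² − m·β₀ − (b₁∕β₀)·log m → Λ`, then for every k the
two-loop sequence of its ultraviolet tail `t(k + ·)` converges to **`Λ + k·β₀`** — the logarithms cancel in the limit.  NO smallness, NO hypothesis on B (pure bookkeeping on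
the sequence). [folklore] -/
theorem twoLoopLambda_tail {β₀ b₁ Λ : ℝ} {t : ℕ → ℝ} (hΛ : Tendsto (fun m : ℕ => 1 / t m ^ 2 - (m : ℝ) * β₀ - b₁ / β₀ * Real.log (m : ℝ)) atTop (𝓝 Λ)) (k : ℕ) :
    Tendsto (fun m : ℕ => 1 / t (k + m) ^ 2 - (m : ℝ) * β₀ - b₁ / β₀ * Real.log (m : ℝ)) atTop (𝓝 (Λ + (k : ℝ) * β₀)) := by
  have h1 : Tendsto (fun m : ℕ => 1 / t (m + k) ^ 2 - ((m + k : ℕ) : ℝ) * β₀ - b₁ / β₀ * Real.log ((m + k : ℕ) : ℝ)) atTop (𝓝 Λ) :=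
    (tendsto_add_atTop_iff_nat k).mpr hΛ
  have h2 := ((tendsto_log_shift_sub k).const_mul (b₁ / β₀)).add_const ((k : ℝ) * β₀)
  rw [mul_zero, zero_add] at h2
  refine ((h1.add h2).congr fun m => ?_)
  push_cast
  rw [Nat.add_comm]
  ring

/-- **THE ABSOLUTE Λ's OF TWO TRAJECTORIES NEAR ZERO PIN DIFFER BY THE RELATIVE Λ.**  Two box solutions h (pin e), h′ (pin e′), `e ≤ e′`, part 14's package at e′, with convergent
two-loop sequences (limits Λ, Λ′, same β₀, b₁): **`(2∕3)(1∕e² − 1∕e′²) ≤ Λ − Λ′ ≤ (4∕3)(1∕e² − 1∕e′²)`** (the difference of the two sequences IS the chart offset of part 34).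
[cite: Balaban1987RG1, Thm 2 (0.31) p.259 with (0.20) p.256 and p.298] -/
theorem twoLoopLambda_sub_mem {B : (ℕ → ℝ) → ℝ} {Cm θ γ β₀ b₁ bs ta gs e e' Λ Λ' : ℝ} {t h h' : ℕ → ℝ}
    (hB : MemoryProfile Cm θ γ B) (hCm : 0 ≤ Cm) (hθ0 : 0 ≤ θ) (hθ1 : θ < 1) (hbs : 0 < bs) (hta : 0 < ta)
    (hts : SeqBox γ t) (htf : MemFlow B gs t) (hprof : ∀ m : ℕ, 1 / ta ^ 2 + bs * (m : ℝ) ≤ 1 / (t m) ^ 2)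
    (he : 0 < e) (hee' : e ≤ e') (h2e' : 2 * e' ≤ γ)
    (hs1 : 4 * Cm * e' ≤ bs * (1 - θ))
    (hs2 : e' ^ 2 * (1 / gs ^ 2 + Cm * γ / (1 - θ) ^ 2 + (2 * Cm / ((1 - θ) * bs)) ^ 2) ≤ 3 / 4)
    (hs4 : 64 * Cm * e' ^ 3 ≤ (1 - θ) ^ 2) (hs5 : Cm * (8 * e' ^ 3 + 16 * e' / bs) ≤ (1 - θ) / 4)
    (hhs : SeqBox γ h) (hhf : MemFlow B e h) (hhs' : SeqBox γ h') (hhf' : MemFlow B e' h')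
    (hΛ : Tendsto (fun m : ℕ => 1 / h m ^ 2 - (m : ℝ) * β₀ - b₁ / β₀ * Real.log (m : ℝ)) atTop (𝓝 Λ))
    (hΛ' : Tendsto (fun m : ℕ => 1 / h' m ^ 2 - (m : ℝ) * β₀ - b₁ / β₀ * Real.log (m : ℝ)) atTop (𝓝 Λ')) :
    2 / 3 * (1 / e ^ 2 - 1 / e' ^ 2) ≤ Λ - Λ' ∧ Λ - Λ' ≤ 4 / 3 * (1 / e ^ 2 - 1 / e' ^ 2) := by
  obtain ⟨Θ, hΘ, hlo, hhi, -⟩ := exists_relativeLambda hB hCm hθ0 hθ1 hbs hta hts htf hprof he hee' h2e' hs1 hs2 hs4 hs5 hhs hhf hhs' hhf'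
  have hdiff : Tendsto (fun m : ℕ => 1 / h m ^ 2 - 1 / h' m ^ 2) atTop (𝓝 (Λ - Λ')) := (hΛ.sub hΛ').congr fun m => by ring
  have e1 : Λ - Λ' = Θ := tendsto_nhds_unique hdiff hΘ
  rw [e1]; exact ⟨hlo, hhi⟩

/-! ## §64 The absolute two-loop Λ as a function of the pin near zero -/

/-- **THE ABSOLUTE TWO-LOOP Λ-PARAMETER IS AN RG-INVARIANT COORDINATE NEAR ZERO PIN.**  `B` with memory profile `(C_m, θ)` on ]0, γ]^ℕ, the value β₀ at the zero history and
the two-loop letter with memory (T2m) `|B(u) − β₀ − b₁u(0)²| ≤ C₂·Σθ^j(u(j)⁴ + |u(j)² − u(0)²|)`; ONE AF reference t; a pin e′ with part 14's package.  THEN there is `Λ₂ : ℝ → ℝ`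
with: (i) for every `e ∈ ]0, e′]` and EVERY box solution h from e, `1∕h(m)² − m·β₀ − (b₁∕β₀)·log m → Λ₂ e`; (ii) for `e₁ ≤ e₂` in ]0, e′]:
**`(2∕3)(1∕e₁² − 1∕e₂²) ≤ Λ₂ e₁ − Λ₂ e₂ ≤ (4∕3)(1∕e₁² − 1∕e₂²)`**; (iii) `StrictAntiOn Λ₂ ]0, e′]`; (iv) `ContinuousOn Λ₂ ]0, e′]`; (v) THE ABEL EQUATION **`Λ₂ (h k) = Λ₂ e + k·β₀`**
along every solution from every `e ∈ ]0, e′]`; (vi) **Λ₂ maps ]0, e′] ONTO [Λ₂ e′, ∞[ with unique pins**.  The absolute two-loop Λ labels the trajectories near the trivial fixed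
point, continuously and monotonically in the infrared coupling, and the renormalization group acts on it by translation by β₀ — no reference trajectory involved.
[cite: Balaban1987RG1, Thm 2 (0.31) p.259 with (0.20) p.256 and p.298] -/
theorem twoLoopLambdaFunction_exists {B : (ℕ → ℝ) → ℝ} {Cm θ γ β₀ b₁ C₂ bs ta gs e' : ℝ} {t : ℕ → ℝ}
    (hB : MemoryProfile Cm θ γ B) (hCm : 0 ≤ Cm) (hθ0 : 0 ≤ θ) (hθ1 : θ < 1) (hC₂ : 0 ≤ C₂) (hbs : 0 < bs) (hta : 0 < ta)
    (h0 : ∀ u : ℕ → ℝ, SeqBox γ u → |B u - β₀| ≤ Cm * ∑' j, θ ^ j * u j)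
    (h2 : ∀ u : ℕ → ℝ, SeqBox γ u → |B u - β₀ - b₁ * u 0 ^ 2| ≤ C₂ * ∑' j, θ ^ j * (u j ^ 4 + |u j ^ 2 - u 0 ^ 2|))
    (hts : SeqBox γ t) (htf : MemFlow B gs t) (hprof : ∀ m : ℕ, 1 / ta ^ 2 + bs * (m : ℝ) ≤ 1 / (t m) ^ 2)
    (he' : 0 < e') (h2e' : 2 * e' ≤ γ)
    (hs1 : 4 * Cm * e' ≤ bs * (1 - θ))
    (hs2 : e' ^ 2 * (1 / gs ^ 2 + Cm * γ / (1 - θ) ^ 2 + (2 * Cm / ((1 - θ) * bs)) ^ 2) ≤ 3 / 4)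
    (hs4 : 64 * Cm * e' ^ 3 ≤ (1 - θ) ^ 2) (hs5 : Cm * (8 * e' ^ 3 + 16 * e' / bs) ≤ (1 - θ) / 4) :
    ∃ Λ₂ : ℝ → ℝ,
      (∀ e ∈ Ioc 0 e', ∀ h : ℕ → ℝ, SeqBox γ h → MemFlow B e h →
        Tendsto (fun m : ℕ => 1 / h m ^ 2 - (m : ℝ) * β₀ - b₁ / β₀ * Real.log (m : ℝ)) atTop (𝓝 (Λ₂ e))) ∧
      (∀ e₁ ∈ Ioc 0 e', ∀ e₂ ∈ Ioc 0 e', e₁ ≤ e₂ →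
        2 / 3 * (1 / e₁ ^ 2 - 1 / e₂ ^ 2) ≤ Λ₂ e₁ - Λ₂ e₂ ∧ Λ₂ e₁ - Λ₂ e₂ ≤ 4 / 3 * (1 / e₁ ^ 2 - 1 / e₂ ^ 2)) ∧
      StrictAntiOn Λ₂ (Ioc 0 e') ∧ ContinuousOn Λ₂ (Ioc 0 e') ∧
      (∀ e ∈ Ioc 0 e', ∀ h : ℕ → ℝ, SeqBox γ h → MemFlow B e h → ∀ k : ℕ, Λ₂ (h k) = Λ₂ e + (k : ℝ) * β₀) ∧
      (∀ y : ℝ, Λ₂ e' ≤ y → ∃! e : ℝ, e ∈ Ioc 0 e' ∧ Λ₂ e = y) := by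
  have h1θ : 0 < 1 - θ := by linarith
  have hγ : 0 ≤ γ := by linarith
  -- the package at every pin of ]0, e′], THE solution there, its AF profile
  have hpk : ∀ e ∈ Ioc (0 : ℝ) e', 4 * Cm * e ≤ bs * (1 - θ) ∧
      e ^ 2 * (1 / gs ^ 2 + Cm * γ / (1 - θ) ^ 2 + (2 * Cm / ((1 - θ) * bs)) ^ 2) ≤ 3 / 4 ∧
      64 * Cm * e ^ 3 ≤ (1 - θ) ^ 2 ∧ Cm * (8 * e ^ 3 + 16 * e / bs) ≤ (1 - θ) / 4 :=
    fun e he => package_of_le hCm hθ1 hbs hγ he.1 he.2 hs1 hs2 hs4 hs5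
  have hsol : ∀ e ∈ Ioc (0 : ℝ) e', SeqBox γ (solution B e) ∧ MemFlow B e (solution B e) := by
    intro e he
    obtain ⟨p1, p2, p4, -⟩ := hpk e he
    obtain ⟨hss, hsf, -, -⟩ := memFlow_solution_of_reference hB hCm hθ0 hθ1 hbs hta hts htf hprof he.1 (by linarith [he.2]) p1 p2 p4
    exact ⟨hss, hsf⟩
  have huniq : ∀ e ∈ Ioc (0 : ℝ) e', ∀ h : ℕ → ℝ, SeqBox γ h → MemFlow B e h → h = solution B e := by
    intro e he h hhs hhf
    obtain ⟨p1, p2, p4, -⟩ := hpk e he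
    exact eq_solution_of_memFlow_of_reference hB hCm hθ0 hθ1 hbs hta hts htf hprof he.1 (by linarith [he.2]) p1 p2 p4 hhs hhf
  have hprofOf : ∀ e ∈ Ioc (0 : ℝ) e', ∀ h : ℕ → ℝ, SeqBox γ h → MemFlow B e h →
      ∀ m : ℕ, 1 / (2 * e) ^ 2 + bs / 4 * (m : ℝ) ≤ 1 / (h m) ^ 2 := by
    intro e he h hhs hhf m
    obtain ⟨p1, p2, -, -⟩ := hpk e he
    have := invSq_lower_of_reference_flow hB hCm hθ0 hθ1 hbs hta hts htf hprof hhs hhf p1 p2 m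
    rwa [show (1 : ℝ) / (2 * e) ^ 2 = 1 / (4 * e ^ 2) by ring]
  -- the two-loop sequence of every box solution from every pin of ]0, e′] converges (part 39)
  have hconv : ∀ e ∈ Ioc (0 : ℝ) e', ∀ h : ℕ → ℝ, SeqBox γ h → MemFlow B e h →
      ∃ Λ : ℝ, Tendsto (fun m : ℕ => 1 / h m ^ 2 - (m : ℝ) * β₀ - b₁ / β₀ * Real.log (m : ℝ)) atTop (𝓝 Λ) := by
    intro e he h hhs hhf
    exact exists_twoLoopLambda hCm hθ0 hθ1 hC₂ (by positivity : 0 < bs / 4) (by have := he.1; positivity : 0 < 2 * e) h0 h2 hhs hhf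
      (hprofOf e he h hhs hhf)
  -- the function
  set Λ₂ : ℝ → ℝ := fun e => limUnder atTop (fun m : ℕ => 1 / (solution B e m) ^ 2 - (m : ℝ) * β₀ - b₁ / β₀ * Real.log (m : ℝ)) with hΛdef
  have hΛ : ∀ e ∈ Ioc (0 : ℝ) e', Tendsto (fun m : ℕ => 1 / (solution B e m) ^ 2 - (m : ℝ) * β₀ - b₁ / β₀ * Real.log (m : ℝ)) atTop (𝓝 (Λ₂ e)) := by
    intro e he
    obtain ⟨hss, hsf⟩ := hsol e he
    obtain ⟨Λ, hΛ⟩ := hconv e he _ hss hsf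
    have e1 : Λ₂ e = Λ := hΛ.limUnder_eq
    rw [e1]; exact hΛ
  have hΛh : ∀ e ∈ Ioc (0 : ℝ) e', ∀ h : ℕ → ℝ, SeqBox γ h → MemFlow B e h →
      Tendsto (fun m : ℕ => 1 / h m ^ 2 - (m : ℝ) * β₀ - b₁ / β₀ * Real.log (m : ℝ)) atTop (𝓝 (Λ₂ e)) := by
    intro e he h hhs hhf
    rw [huniq e he h hhs hhf]
    exact hΛ e he
  -- (ii) two-sided bounds
  have hbounds : ∀ e₁ ∈ Ioc (0 : ℝ) e', ∀ e₂ ∈ Ioc (0 : ℝ) e', e₁ ≤ e₂ →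
      2 / 3 * (1 / e₁ ^ 2 - 1 / e₂ ^ 2) ≤ Λ₂ e₁ - Λ₂ e₂ ∧ Λ₂ e₁ - Λ₂ e₂ ≤ 4 / 3 * (1 / e₁ ^ 2 - 1 / e₂ ^ 2) := by
    intro e₁ he₁ e₂ he₂ h12
    obtain ⟨hss₁, hsf₁⟩ := hsol e₁ he₁
    obtain ⟨hss₂, hsf₂⟩ := hsol e₂ he₂
    obtain ⟨p1, p2, p4, p5⟩ := hpk e₂ he₂
    exact twoLoopLambda_sub_mem hB hCm hθ0 hθ1 hbs hta hts htf hprof he₁.1 h12 (by linarith [he₂.2]) p1 p2 p4 p5 hss₁ hsf₁ hss₂ hsf₂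
      (hΛ e₁ he₁) (hΛ e₂ he₂)
  -- (iii) strictly decreasing
  have hanti : StrictAntiOn Λ₂ (Ioc 0 e') := by
    intro e₁ he₁ e₂ he₂ h12
    have hΔ : 0 < 1 / e₁ ^ 2 - 1 / e₂ ^ 2 := by
      rw [sub_pos]; exact one_div_lt_one_div_of_lt (by have := he₁.1; positivity) (pow_lt_pow_left₀ h12 he₁.1.le two_ne_zero)
    have := (hbounds e₁ he₁ e₂ he₂ h12.le).1
    show Λ₂ e₂ < Λ₂ e₁
    linarith
  -- (iv) continuous
  have hcont : ContinuousOn Λ₂ (Ioc 0 e') := by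
    have hinv : ContinuousOn (fun s : ℝ => 1 / s ^ 2) (Ioc 0 e') :=
      continuousOn_const.div (continuousOn_id.pow 2) fun s hs => (pow_pos hs.1 2).ne'
    rw [Metric.continuousOn_iff] at hinv ⊢
    intro s hs ε hε
    obtain ⟨η, hη, hηs⟩ := hinv s hs (ε / 2) (by positivity)
    refine ⟨η, hη, fun s' hs' hd => ?_⟩
    have h1 := hηs s' hs' hd
    rw [Real.dist_eq] at h1 ⊢
    rcases le_total s' s with hle | hle
    · have h3 := hbounds s' hs' s hs hle
      rw [abs_of_nonneg (by linarith [h3.1, (abs_nonneg (1 / s' ^ 2 - 1 / s ^ 2))] : (0 : ℝ) ≤ Λ₂ s' - Λ₂ s)]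
      have : 1 / s' ^ 2 - 1 / s ^ 2 ≤ |1 / s' ^ 2 - 1 / s ^ 2| := le_abs_self _
      linarith [h3.2]
    · have h3 := hbounds s hs s' hs' hle
      rw [abs_sub_comm, abs_of_nonneg (by linarith [h3.1, (abs_nonneg (1 / s ^ 2 - 1 / s' ^ 2))] : (0 : ℝ) ≤ Λ₂ s - Λ₂ s')]
      have : 1 / s ^ 2 - 1 / s' ^ 2 ≤ |1 / s' ^ 2 - 1 / s ^ 2| := by rw [abs_sub_comm]; exact le_abs_self _
      linarith [h3.2]
  -- (v) the Abel equation
  have habel : ∀ e ∈ Ioc (0 : ℝ) e', ∀ h : ℕ → ℝ, SeqBox γ h → MemFlow B e h → ∀ k : ℕ, Λ₂ (h k) = Λ₂ e + (k : ℝ) * β₀ := by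
    intro e he h hhs hhf k
    obtain ⟨p1, p2, -, -⟩ := hpk e he
    have hmono := succ_le_of_reference_flow hB hCm hθ0 hθ1 hbs hta h0 hts htf hprof hhs hhf p1 p2 k
    have hkmem : h k ∈ Ioc (0 : ℝ) e' := ⟨(hhs k).1, hmono.2.2.trans he.2⟩
    have htail_lim := hΛh (h k) hkmem (fun j => h (k + j)) (seqBox_shift hhs k) (memFlow_tail hhf k)
    have hlim := hΛh e he h hhs hhf
    have hshift := twoLoopLambda_tail hlim k
    exact tendsto_nhds_unique htail_lim hshift
  -- (vi) onto [Λ₂ e′, ∞[ with unique pins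
  have he'mem : e' ∈ Ioc (0 : ℝ) e' := ⟨he', le_rfl⟩
  have hsurj : ∀ y : ℝ, Λ₂ e' ≤ y → ∃! e : ℝ, e ∈ Ioc 0 e' ∧ Λ₂ e = y := by
    intro y hy
    set S : ℝ := 1 / e' ^ 2 + 3 / 2 * (y - Λ₂ e') with hS
    have hS0 : 0 < S := by have : 0 < 1 / e' ^ 2 := by positivity
                           rw [hS]; nlinarith
    set e₀ : ℝ := 1 / Real.sqrt S with he₀
    have he₀0 : 0 < e₀ := one_div_pos.mpr (Real.sqrt_pos.mpr hS0)
    have he₀sq : 1 / e₀ ^ 2 = S := one_div_sq_one_div_sqrt hS0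
    have he₀le : e₀ ≤ e' := by
      have h1 : 1 / e' ^ 2 ≤ 1 / e₀ ^ 2 := by rw [he₀sq, hS]; nlinarith
      have h3 : e₀ ^ 2 ≤ e' ^ 2 := (one_div_le_one_div (pow_pos he' 2) (pow_pos he₀0 2)).mp h1
      exact (pow_le_pow_iff_left₀ he₀0.le he'.le two_ne_zero).mp h3
    have he₀mem : e₀ ∈ Ioc (0 : ℝ) e' := ⟨he₀0, he₀le⟩
    have hge : y ≤ Λ₂ e₀ := by
      have := (hbounds e₀ he₀mem e' he'mem he₀le).1
      rw [he₀sq, hS] at this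
      linarith
    have hIcc : Icc e₀ e' ⊆ Ioc 0 e' := fun x hx => ⟨he₀0.trans_le hx.1, hx.2⟩
    have hivt := intermediate_value_Icc' he₀le (hcont.mono hIcc)
    obtain ⟨x, hx, hxy⟩ := hivt ⟨hy, hge⟩
    refine ⟨x, ⟨hIcc hx, hxy⟩, fun x' hx' => ?_⟩
    exact hanti.injOn hx'.1 (hIcc hx) (hx'.2.trans hxy.symm)
  exact ⟨Λ₂, hΛh, hbounds, hanti, hcont, habel, hsurj⟩

end

end Summit.QuantumFields.BalabanUV.Beta.EriceFlowEnclosureB12AsPrintedHistoryContagionShiftFlowZeroTwoLoopPin
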